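import Mathlib
import HarnessLib
import Literature.NumberTheory.Transcendental.KZCalculus

/-!
# Route LinRedNormalForm, item `ResidualBeyondGenusZero` (stmt-KontsevichZagierPeriods-3917): the assembly of the dimension-one split, import-light

`ResidualBeyondGenusZero` (RES) is the DECLARED RESIDUAL of route LinRedNormalForm (summit-strength;
planner-held). Its crux-strategist BC2 redirect (2026-08-17, `Cruxes/ResidualBeyondGenusZero/SPLIT.md`,
registered line `Cruxes/ResidualBeyondGenusZero/Lines/dim_one_splice.lean`) is the typed decomposition
along the ONE-DIMENSIONAL sector

  `RES ⇐ DimOneKernelInKZ ∧ DimOneSeparation ∧ ResidualBeyondDimOne`,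

with, one rung up the dimension ladder,

  `ResidualBeyondDimOne ⇐ (relative kernel of the two-dimensional sector) ∧ (residual beyond dimension two)`.

This file lands both assemblies with the piece statements INLINED over `Literature` declarations only
(no `Theses` import), so that the route file can import it and the split can be filed with
`--glue-by Summit.KontsevichZagierPeriods.ResidualBeyondGenusZero.residualBeyondGenusZero_of_dimOnePieces`
(its type is literally `DimOneKernelInKZ → DimOneSeparation → ResidualBeyondDimOne → ResidualBeyondGenusZero`
after unfolding the four route definitions). The proofs are soundness of the calculus
(`KZ.relations_le_ker_eval_holds`) plus subgroup algebra, isolated once and for all in two abstract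
lattice lemmas over an arbitrary additive hom `f : M →+ B` and a subgroup `R ≤ ker f`:

* `residual_descend` — ONE RUNG: a relative kernel `T → S (mod R)` on vanishing elements and a residual
  onto `T` give the residual onto `S`;
* `residual_of_kernel_of_separation` — THE SPLICE: a kernel statement on `N`, a separation of vanishing
  elements of the joint `J` into `G + (vanishing N)` modulo `R`, and a residual onto `J` give the
  residual onto `G`.

References: M. Kontsevich, D. Zagier, *Periods* (2001), §1.2, Conjecture 1; A. Huber, G. Wüstholz,
*Transcendence and Linear Relations of 1-Periods* (2022), Thm 13.3 (2); F. Brown, Ann. ENS 42 (2009),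
Thm 1.1; A. Huber, S. Müller-Stach, *Periods and Nori Motives* (2017), Conj. 13.2.1.
-/

noncomputable section

namespace Summit.KontsevichZagierPeriods.ResidualBeyondGenusZero

open Literature.NumberTheory.Transcendental

/-! ## §1 Two abstract lattice lemmas (soundness + subgroup algebra) -/

/-- **One rung of the ladder.** Let `f : M →+ B`, `R ≤ ker f`, and `S, T ≤ M`. If every VANISHING
element of `T` is congruent modulo `R` to an element of `S` (relative kernel), and every vanishing
element of `M` is congruent modulo `R` to an element of `T` (residual onto `T`), then every vanishing
element of `M` is congruent modulo `R` to an element of `S` (residual onto `S`): the intermediate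
element vanishes by soundness, and the two congruences add. [folklore] -/
theorem residual_descend {M B : Type*} [AddCommGroup M] [AddCommGroup B] (f : M →+ B)
    {R S T : AddSubgroup M} (hR : R ≤ f.ker)
    (hRel : ∀ m ∈ T, f m = 0 → ∃ s ∈ S, m - s ∈ R)
    (hRes : ∀ c : M, f c = 0 → ∃ t ∈ T, c - t ∈ R) :
    ∀ c : M, f c = 0 → ∃ s ∈ S, c - s ∈ R := by
  intro c hc
  obtain ⟨t, ht, hct⟩ := hRes c hc
  have ht0 : f t = 0 := by
    have h := (AddMonoidHom.mem_ker).1 (hR hct)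
    rw [map_sub, hc, zero_sub, neg_eq_zero] at h
    exact h
  obtain ⟨s, hs, hts⟩ := hRel t ht ht0
  refine ⟨s, hs, ?_⟩
  have e : c - s = (c - t) + (t - s) := by abel
  rw [e]
  exact add_mem hct hts

/-- **The splice.** Let `f : M →+ B`, `R ≤ ker f`, and `G, N, J ≤ M`. If every vanishing element of `N`
lies in `R` (kernel statement on `N`), every vanishing element of `J` is congruent modulo `R` to
`g + h` with `g ∈ G` and `h ∈ N` VANISHING (separation), and every vanishing element of `M` is
congruent modulo `R` to an element of `J` (residual onto `J`), then every vanishing element of `M` is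
congruent modulo `R` to an element of `G` (residual onto `G`). [folklore] -/
theorem residual_of_kernel_of_separation {M B : Type*} [AddCommGroup M] [AddCommGroup B] (f : M →+ B)
    {R G N J : AddSubgroup M} (hR : R ≤ f.ker)
    (hK : ∀ h ∈ N, f h = 0 → h ∈ R)
    (hSep : ∀ m ∈ J, f m = 0 → ∃ g ∈ G, ∃ h ∈ N, f h = 0 ∧ m - g - h ∈ R)
    (hRes : ∀ c : M, f c = 0 → ∃ j ∈ J, c - j ∈ R) :
    ∀ c : M, f c = 0 → ∃ g ∈ G, c - g ∈ R := by
  intro c hc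
  obtain ⟨j, hj, hcj⟩ := hRes c hc
  have hj0 : f j = 0 := by
    have h := (AddMonoidHom.mem_ker).1 (hR hcj)
    rw [map_sub, hc, zero_sub, neg_eq_zero] at h
    exact h
  obtain ⟨g, hg, h, hh, hh0, hsep⟩ := hSep j hj hj0
  refine ⟨g, hg, ?_⟩
  have e : c - g = (c - j) + (j - g - h) + h := by abel
  rw [e]
  exact add_mem (add_mem hcj hsep) (hK h hh hh0)

/-! ## §2 The assembly of the dimension-one split (glue of the split; pieces verbatim, inlined) -/

/-- **`ResidualBeyondGenusZero` from the three pieces of its dimension-one split** (glue of the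
crux-strategist BC2 redirect of stmt-KontsevichZagierPeriods-3917; pieces verbatim the children of
`SPLIT.md`, inlined over `Literature` declarations): piece 1 `DimOneKernelInKZ` (every vanishing
`ℤ`-combination of one-dimensional representations is a relation), piece 2 `DimOneSeparation` (a
vanishing element of `closure (GZ ∪ D₁)` is, modulo relations, a genus-zero combination plus a
VANISHING one-dimensional one), piece 3 `ResidualBeyondDimOne` (the smaller declared residual beyond
`GZ ∪ D₁`) together give RES, by `residual_of_kernel_of_separation` over the soundness of the
calculus `KZ.relations_le_ker_eval_holds`. [folklore] -/
theorem residualBeyondGenusZero_of_dimOnePieces : (∀ h ∈ AddSubgroup.closure (Set.range fun r : Literature.NumberTheory.Transcendental.KZ.IntegralRep 1 => Literature.NumberTheory.Transcendental.KZ.of r), Literature.NumberTheory.Transcendental.KZ.eval h = 0 → h ∈ Literature.NumberTheory.Transcendental.KZ.relations) → (∀ m ∈ AddSubgroup.closure ({x : Literature.NumberTheory.Transcendental.KZ.FormalRep | ∃ (k : ℕ) (r : Literature.NumberTheory.Transcendental.KZ.IntegralRep k) (p : MvPolynomial (Fin k) ℚ) (a : Fin k → Fin k → ℕ) (b c : Fin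 k → ℕ), r.domain = {t | (∀ i, 0 < t i) ∧ (∀ i, t i < 1) ∧ StrictAnti t} ∧ Set.EqOn r.integrand (fun t => MvPolynomial.aeval t p / ((∏ i, t i ^ b i) * (∏ i, (1 - t i) ^ c i) * ∏ i, ∏ j, if i < j then (t i - t j) ^ a i j else 1)) r.domain ∧ x = Literature.NumberTheory.Transcendental.KZ.of r} ∪ Set.range fun r : Literature.NumberTheory.Transcendental.KZ.IntegralRep 1 => Literature.NumberTheory.Transcendental.KZ.of r), Literature.NumberTheory.Transcendental.KZ.eval m = 0 → ∃ g ∈ AddSubgroup.closure {x : Literature.NumberTheory.Transcendental.KZ.FormalRep | ∃ (k : ℕ) (r : Literature.NumberTheory.Transcendental.KZ.IntegralRep k) (p : MvPolynomial (Fin k) ℚ) (a : Fin k → Fin k → ℕ) (b c : Fin k → ℕ), r.domain = {t | (∀ i, 0 < t i) ∧ (∀ i, t i < 1) ∧ StrictAnti t} ∧ Set.EqOn r.integrand (fun t => MvPolynomial.aeval t p / ((∏ i, t i ^ b i) * (∏ i, (1 - t i) ^ c i) * ∏ i, ∏ j, if i < j then (t i - t j) ^ a i j else 1)) r.domain ∧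 x = Literature.NumberTheory.Transcendental.KZ.of r}, ∃ h ∈ AddSubgroup.closure (Set.range fun r : Literature.NumberTheory.Transcendental.KZ.IntegralRep 1 => Literature.NumberTheory.Transcendental.KZ.of r), Literature.NumberTheory.Transcendental.KZ.eval h = 0 ∧ m - g - h ∈ Literature.NumberTheory.Transcendental.KZ.relations) → (∀ c : Literature.NumberTheory.Transcendental.KZ.FormalRep, Literature.NumberTheory.Transcendental.KZ.eval c = 0 → ∃ c₁ ∈ AddSubgroup.closure ({x : Literature.NumberTheory.Transcendental.KZ.FormalRep | ∃ (k : ℕ) (r : Literature.NumberTheory.Transcendental.KZ.IntegralRep k) (p : MvPolynomial (Fin k) ℚ) (a : Fin k → Fin k → ℕ) (b c : Fin k → ℕ), r.domain = {t | (∀ i, 0 < t i) ∧ (∀ i, t i < 1) ∧ StrictAnti t} ∧ Set.EqOn r.integrand (fun t => MvPolynomial.aeval t p / ((∏ i, t i ^ b i) * (∏ i, (1 - t i) ^ c i) * ∏ i, ∏ j, if i < j then (t i - t j) ^ a i j else 1)) r.domain ∧ x = Literature.NumberTheory.Transcendental.KZ.of r} ∪ Set.range fun r : Literature.NumberTheory.Transcendental.KZ.IntegralRep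 1 => Literature.NumberTheory.Transcendental.KZ.of r), c - c₁ ∈ Literature.NumberTheory.Transcendental.KZ.relations) → ∀ c : Literature.NumberTheory.Transcendental.KZ.FormalRep, Literature.NumberTheory.Transcendental.KZ.eval c = 0 → ∃ c₀ ∈ AddSubgroup.closure {x : Literature.NumberTheory.Transcendental.KZ.FormalRep | ∃ (k : ℕ) (r : Literature.NumberTheory.Transcendental.KZ.IntegralRep k) (p : MvPolynomial (Fin k) ℚ) (a : Fin k → Fin k → ℕ) (b c : Fin k → ℕ), r.domain = {t | (∀ i, 0 < t i) ∧ (∀ i, t i < 1) ∧ StrictAnti t} ∧ Set.EqOn r.integrand (fun t => MvPolynomial.aeval t p / ((∏ i, t i ^ b i) * (∏ i, (1 - t i) ^ c i) * ∏ i, ∏ j, if i < j then (t i - t j) ^ a i j else 1)) r.domain ∧ x = Literature.NumberTheory.Transcendental.KZ.of r}, c - c₀ ∈ Literature.NumberTheory.Transcendental.KZ.relations :=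
  fun hK hSep hRes =>
  residual_of_kernel_of_separation KZ.eval KZ.relations_le_ker_eval_holds hK hSep hRes

/-! ## §3 One rung up: `ResidualBeyondDimOne` from the two-dimensional relative kernel and the residual beyond dimension two -/

/-- **Piece 3 from the next rung of the dimension ladder** (the registered plan of
`ResidualBeyondDimOne`, stubs 5–6 of line `dim-one-splice`): if every vanishing element of
`closure (GZ ∪ D₁ ∪ D₂)` is congruent modulo `KZ.relations` to an element of `closure (GZ ∪ D₁)`
(relative kernel of the two-dimensional sector) and every vanishing formal combination is congruent
modulo `KZ.relations` to an element of `closure (GZ ∪ D₁ ∪ D₂)` (residual beyond dimension two), then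
`ResidualBeyondDimOne`; by `residual_descend`. [folklore] -/
theorem residualBeyondDimOne_of_dimTwoPieces
    (hRel : ∀ m ∈ AddSubgroup.closure (({x : Literature.NumberTheory.Transcendental.KZ.FormalRep | ∃ (k : ℕ) (r : Literature.NumberTheory.Transcendental.KZ.IntegralRep k) (p : MvPolynomial (Fin k) ℚ) (a : Fin k → Fin k → ℕ) (b c : Fin k → ℕ), r.domain = {t | (∀ i, 0 < t i) ∧ (∀ i, t i < 1) ∧ StrictAnti t} ∧ Set.EqOn r.integrand (fun t => MvPolynomial.aeval t p / ((∏ i, t i ^ b i) * (∏ i, (1 - t i) ^ c i) * ∏ i, ∏ j, if i < j then (t i - t j) ^ a i j else 1)) r.domain ∧ x = Literature.NumberTheory.Transcendental.KZ.of r} ∪ Set.range fun r : Literature.NumberTheory.Transcendental.KZ.IntegralRep 1 => Literature.NumberTheory.Transcendental.KZ.of r) ∪ Set.range fun r : Literature.NumberTheory.Transcendental.KZ.IntegralRep 2 => Literature.NumberTheory.Transcendental.KZ.of r), Literature.NumberTheory.Transcendental.KZ.eval m = 0 → ∃ c₁ ∈ AddSubgroup.closure ({x : Literature.NumberTheory.Transcendental.KZ.FormalRep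 | ∃ (k : ℕ) (r : Literature.NumberTheory.Transcendental.KZ.IntegralRep k) (p : MvPolynomial (Fin k) ℚ) (a : Fin k → Fin k → ℕ) (b c : Fin k → ℕ), r.domain = {t | (∀ i, 0 < t i) ∧ (∀ i, t i < 1) ∧ StrictAnti t} ∧ Set.EqOn r.integrand (fun t => MvPolynomial.aeval t p / ((∏ i, t i ^ b i) * (∏ i, (1 - t i) ^ c i) * ∏ i, ∏ j, if i < j then (t i - t j) ^ a i j else 1)) r.domain ∧ x = Literature.NumberTheory.Transcendental.KZ.of r} ∪ Set.range fun r : Literature.NumberTheory.Transcendental.KZ.IntegralRep 1 => Literature.NumberTheory.Transcendental.KZ.of r), m - c₁ ∈ Literature.NumberTheory.Transcendental.KZ.relations)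
    (hRes : ∀ c : Literature.NumberTheory.Transcendental.KZ.FormalRep, Literature.NumberTheory.Transcendental.KZ.eval c = 0 → ∃ c₂ ∈ AddSubgroup.closure (({x : Literature.NumberTheory.Transcendental.KZ.FormalRep | ∃ (k : ℕ) (r : Literature.NumberTheory.Transcendental.KZ.IntegralRep k) (p : MvPolynomial (Fin k) ℚ) (a : Fin k → Fin k → ℕ) (b c : Fin k → ℕ), r.domain = {t | (∀ i, 0 < t i) ∧ (∀ i, t i < 1) ∧ StrictAnti t} ∧ Set.EqOn r.integrand (fun t => MvPolynomial.aeval t p / ((∏ i, t i ^ b i) * (∏ i, (1 - t i) ^ c i) * ∏ i, ∏ j, if i < j then (t i - t j) ^ a i j else 1)) r.domain ∧ x = Literature.NumberTheory.Transcendental.KZ.of r} ∪ Set.range fun r : Literature.NumberTheory.Transcendental.KZ.IntegralRep 1 => Literature.NumberTheory.Transcendental.KZ.of r) ∪ Set.range fun r : Literature.NumberTheory.Transcendental.KZ.IntegralRep 2 => Literature.NumberTheory.Transcendental.KZ.of r), c - c₂ ∈ Literature.NumberTheory.Transcendental.KZ.relations) :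
    ∀ c : Literature.NumberTheory.Transcendental.KZ.FormalRep, Literature.NumberTheory.Transcendental.KZ.eval c = 0 → ∃ c₁ ∈ AddSubgroup.closure ({x : Literature.NumberTheory.Transcendental.KZ.FormalRep | ∃ (k : ℕ) (r : Literature.NumberTheory.Transcendental.KZ.IntegralRep k) (p : MvPolynomial (Fin k) ℚ) (a : Fin k → Fin k → ℕ) (b c : Fin k → ℕ), r.domain = {t | (∀ i, 0 < t i) ∧ (∀ i, t i < 1) ∧ StrictAnti t} ∧ Set.EqOn r.integrand (fun t => MvPolynomial.aeval t p / ((∏ i, t i ^ b i) * (∏ i, (1 - t i) ^ c i) * ∏ i, ∏ j, if i < j then (t i - t j) ^ a i j else 1)) r.domain ∧ x = Literature.NumberTheory.Transcendental.KZ.of r} ∪ Set.range fun r : Literature.NumberTheory.Transcendental.KZ.IntegralRep 1 => Literature.NumberTheory.Transcendental.KZ.of r), c - c₁ ∈ Literature.NumberTheory.Transcendental.KZ.relations :=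
  residual_descend KZ.eval KZ.relations_le_ker_eval_holds hRel hRes

/-! ## §4 Every rung is implied by the kernel statement -/

/-- **Every rung is kernel-implied.** If every vanishing formal combination is a relation (the kernel
form of Conjecture 1, `KZKernelConjecture` unfolded), then for ANY two generator sets `S, T` the
relative kernel `T → S (mod relations)` holds on vanishing elements (take `0 ∈ closure S`), and the
residual onto `S` holds; so no rung of the dimension ladder is stronger than the kernel conjecture,
which the summit implies. [folklore] -/
theorem relativeKernel_and_residual_of_kernel
    (hKer : ∀ c : KZ.FormalRep, KZ.eval c = 0 → c ∈ KZ.relations) (S T : Set KZ.FormalRep) :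
    (∀ m ∈ AddSubgroup.closure T, KZ.eval m = 0 → ∃ s ∈ AddSubgroup.closure S, m - s ∈ KZ.relations) ∧
    (∀ c : KZ.FormalRep, KZ.eval c = 0 → ∃ s ∈ AddSubgroup.closure S, c - s ∈ KZ.relations) :=
  ⟨fun m _ hm0 => ⟨0, zero_mem _, by simpa using hKer m hm0⟩,
    fun c hc => ⟨0, zero_mem _, by simpa using hKer c hc⟩⟩

end Summit.KontsevichZagierPeriods.ResidualBeyondGenusZero

end
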